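import Literature.AlgebraicGeometry.Frobenioids.OrderedHomIsoConjugation
import HarnessLib

/-!
# Frobenioids II, §0 (p. 6): quasi-totally / quasi-continuously ordered monomorphisms and the two
# "quasi" types are invariant under equivalences of categories

Mochizuki, *The geometry of Frobenioids II: poly-Frobenioids*, Kyushu J. Math. **62** (2008)
401–460, §0 "Notations and Conventions", paragraph **Categories**, kurims text p. 6
[cite: MochizukiFrdII2008, §0 p.6]: "a morphism of `C^↣` [i.e., a monomorphism of `C`] is
*quasi-totally ordered* (respectively, *quasi-continuously ordered*) if it is an isomorphism or factors
as a finite composite of totally ordered (respectively, continuously ordered) morphisms"; "`C` is of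
… quasi-totally ordered … quasi-continuously ordered type" if every morphism of `C` is.  Typed in
`Dissection.lean` (abc-iut-L1-t4: `IsFiniteCompositeOf`, `IsQuasiTotallyOrderedHom`,
`IsQuasiContinuouslyOrderedHom`, `IsOfQuasiTotallyOrderedType`, `IsOfQuasiContinuouslyOrderedType`).

Sequel to `OrderedHomEquivalenceTransport.lean` (four of the six ordered types) and
`OrderedHomIsoConjugation.lean` (isomorphisms are continuously ordered; stability under composition
with isomorphisms).  PROOF-ONLY (no definitions, no instances).  Contents:

* `isQuasiTotallyOrderedHom_iff_isFiniteCompositeOf`, `isQuasiContinuouslyOrderedHom_iff_…`: the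
  clause "is an isomorphism or" is redundant (an isomorphism is itself continuously ordered);
* `IsFiniteCompositeOf.map_functor`, `….iso_comp`, `….comp_iso`: finite composites of `P`-arrows are
  pushed forward along functors and absorb isomorphisms at either end when `P` does;
* `IsQuasiTotallyOrderedHom.conj`, `IsQuasiContinuouslyOrderedHom.conj` (composition with
  isomorphisms), `isQuasiTotallyOrderedHom_map_equivalence_iff`,
  `isQuasiContinuouslyOrderedHom_map_equivalence_iff` (for an equivalence `e : C ≌ D`), and the
  remaining two types `isOfQuasiTotallyOrderedType_iff_of_equivalence`,
  `isOfQuasiContinuouslyOrderedType_iff_of_equivalence` — so all six ordered "types" of [FrdII] §0 p. 6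
  (with `OrderedHomEquivalenceTransport.lean`) are invariants of the category up to equivalence, as the
  paper uses tacitly whenever such a type is read off an equivalent category.

Elementary category theory; nothing here bears on the disputed [IUTchIII] Cor. 3.12 or takes a side;
no FACT-LIST row is asserted (abc-iut cell, seat abc-iut-f-031, by-product of tranche 31
`IsOfQuasiTotallyOrderedType` F-2334).
-/

namespace Literature.AlgebraicGeometry.Frobenioids

open CategoryTheory

universe v₁ v₂ u₁ u₂

section Conj

variable {C : Type u₁} [Category.{v₁} C]

/-! ### The clause "is an isomorphism or" is redundant -/

/-- Since an isomorphism is itself totally ordered (`IsTotallyOrderedHom.of_isIso`), "is an isomorphism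
or factors as a finite composite of totally ordered morphisms" is the same as "factors as a finite
composite of totally ordered morphisms". [cite: MochizukiFrdII2008, §0 p.6] -/
theorem isQuasiTotallyOrderedHom_iff_isFiniteCompositeOf {A B : C} (φ : A ⟶ B) :
    IsQuasiTotallyOrderedHom φ ↔
      Mono φ ∧ IsFiniteCompositeOf (fun _ _ f => IsTotallyOrderedHom f) φ := by
  refine and_congr_right fun _ => ⟨fun h => h.elim (fun hiso => ?_) id, Or.inr⟩
  haveI := hiso
  exact .single φ (IsTotallyOrderedHom.of_isIso φ)

/-- Likewise for quasi-continuously ordered. [cite: MochizukiFrdII2008, §0 p.6] -/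
theorem isQuasiContinuouslyOrderedHom_iff_isFiniteCompositeOf {A B : C} (φ : A ⟶ B) :
    IsQuasiContinuouslyOrderedHom φ ↔
      Mono φ ∧ IsFiniteCompositeOf (fun _ _ f => IsContinuouslyOrderedHom f) φ := by
  refine and_congr_right fun _ => ⟨fun h => h.elim (fun hiso => ?_) id, Or.inr⟩
  haveI := hiso
  exact .single φ (IsContinuouslyOrderedHom.of_isIso φ)

/-! ### Finite composites: functors, isomorphisms at the ends -/

/-- A functor carries a finite composite of `P`-arrows to a finite composite of `Q`-arrows whenever
it carries `P`-arrows to `Q`-arrows. [cite: MochizukiFrdII2008, §0 p.6] -/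
theorem IsFiniteCompositeOf.map_functor {D : Type u₂} [Category.{v₂} D] (F : C ⥤ D)
    {P : MorphismProperty C} {Q : MorphismProperty D}
    (hPQ : ∀ {A B : C} (f : A ⟶ B), P f → Q (F.map f)) {A B : C} {f : A ⟶ B}
    (h : IsFiniteCompositeOf P f) : IsFiniteCompositeOf Q (F.map f) := by
  induction h with
  | single f hf => exact .single _ (hPQ f hf)
  | comp f g _ hg ih =>
    rw [F.map_comp]
    exact .comp _ _ ih (hPQ g hg)

/-- If `P` absorbs isomorphisms on the left, so do finite composites of `P`-arrows.
[cite: MochizukiFrdII2008, §0 p.6] -/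
theorem IsFiniteCompositeOf.iso_comp {P : MorphismProperty C}
    (hP : ∀ {A A' B : C} (i : A' ≅ A) (f : A ⟶ B), P f → P (i.hom ≫ f)) {A B : C} {f : A ⟶ B}
    (h : IsFiniteCompositeOf P f) : ∀ {A' : C} (i : A' ≅ A), IsFiniteCompositeOf P (i.hom ≫ f) := by
  induction h with
  | single f hf => exact fun i => .single _ (hP i f hf)
  | comp f g _ hg ih =>
    intro A' i
    rw [← Category.assoc]
    exact .comp _ _ (ih i) hg

/-- If `P` absorbs isomorphisms on the right, so do finite composites of `P`-arrows.
[cite: MochizukiFrdII2008, §0 p.6] -/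
theorem IsFiniteCompositeOf.comp_iso {P : MorphismProperty C}
    (hP : ∀ {A B B' : C} (f : A ⟶ B) (j : B ≅ B'), P f → P (f ≫ j.hom)) {A B B' : C} {f : A ⟶ B}
    (h : IsFiniteCompositeOf P f) (j : B ≅ B') : IsFiniteCompositeOf P (f ≫ j.hom) := by
  cases h with
  | single f hf => exact .single _ (hP f j hf)
  | comp f g hf hg =>
    rw [Category.assoc]
    exact .comp _ _ hf (hP g j hg)

/-- `i ≫ φ ≫ j` is quasi-totally ordered if `φ` is (`i`, `j` isomorphisms).
[cite: MochizukiFrdII2008, §0 p.6] -/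
theorem IsQuasiTotallyOrderedHom.conj {A A' B B' : C} (i : A' ≅ A) (j : B ≅ B') {φ : A ⟶ B}
    {φ' : A' ⟶ B'} (hφ' : φ' = i.hom ≫ φ ≫ j.hom) (h : IsQuasiTotallyOrderedHom φ) :
    IsQuasiTotallyOrderedHom φ' := by
  subst hφ'
  haveI := h.1
  refine ⟨inferInstance, h.2.imp (fun hiso => ?_) fun hc => ?_⟩
  · haveI := hiso
    infer_instance
  · have h1 : IsFiniteCompositeOf (fun _ _ f => IsTotallyOrderedHom f) (i.hom ≫ φ) :=
      hc.iso_comp (P := fun _ _ f => IsTotallyOrderedHom f) (fun i f hf => hf.iso_comp i) i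
    have h2 := h1.comp_iso (P := fun _ _ f => IsTotallyOrderedHom f) (fun f j hf => hf.comp_iso j) j
    simpa only [Category.assoc] using h2

/-- `i ≫ φ ≫ j` is quasi-continuously ordered if `φ` is (`i`, `j` isomorphisms).
[cite: MochizukiFrdII2008, §0 p.6] -/
theorem IsQuasiContinuouslyOrderedHom.conj {A A' B B' : C} (i : A' ≅ A) (j : B ≅ B') {φ : A ⟶ B}
    {φ' : A' ⟶ B'} (hφ' : φ' = i.hom ≫ φ ≫ j.hom) (h : IsQuasiContinuouslyOrderedHom φ) :
    IsQuasiContinuouslyOrderedHom φ' := by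
  subst hφ'
  haveI := h.1
  refine ⟨inferInstance, h.2.imp (fun hiso => ?_) fun hc => ?_⟩
  · haveI := hiso
    infer_instance
  · have h1 : IsFiniteCompositeOf (fun _ _ f => IsContinuouslyOrderedHom f) (i.hom ≫ φ) :=
      hc.iso_comp (P := fun _ _ f => IsContinuouslyOrderedHom f) (fun i f hf => hf.iso_comp i) i
    have h2 :=
      h1.comp_iso (P := fun _ _ f => IsContinuouslyOrderedHom f) (fun f j hf => hf.comp_iso j) j
    simpa only [Category.assoc] using h2

end Conj

/-! ### The quasi notions and the remaining two types under an equivalence -/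

section Equivalence

variable {C : Type u₁} [Category.{v₁} C] {D : Type u₂} [Category.{v₂} D] (e : C ≌ D)

/-- An equivalence carries quasi-totally ordered monomorphisms to quasi-totally ordered monomorphisms
(push the finite composite forward). [cite: MochizukiFrdII2008, §0 p.6] -/
theorem IsQuasiTotallyOrderedHom.map_equivalence {A B : C} {φ : A ⟶ B}
    (h : IsQuasiTotallyOrderedHom φ) : IsQuasiTotallyOrderedHom (e.functor.map φ) := by
  haveI := h.1
  refine ⟨inferInstance, h.2.imp (fun hiso => ?_) fun hc => ?_⟩
  · haveI := hiso
    infer_instance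
  · exact hc.map_functor e.functor (Q := fun _ _ f => IsTotallyOrderedHom f)
      fun f hf => (isTotallyOrderedHom_map_equivalence_iff e f).mpr hf

/-- Conversely (apply the previous statement to `e⁻¹` and absorb the unit isomorphisms).
[cite: MochizukiFrdII2008, §0 p.6] -/
theorem IsQuasiTotallyOrderedHom.of_map_equivalence {A B : C} {φ : A ⟶ B}
    (h : IsQuasiTotallyOrderedHom (e.functor.map φ)) : IsQuasiTotallyOrderedHom φ :=
  (h.map_equivalence e.symm).conj (e.unitIso.app A) (e.unitIso.app B).symm
    (by
      show φ = e.unitIso.hom.app A ≫ (e.functor ⋙ e.inverse).map φ ≫ e.unitIso.inv.app B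
      rw [← Category.assoc, ← e.unitIso.hom.naturality φ, Category.assoc, Iso.hom_inv_id_app]
      exact (Category.comp_id φ).symm)

/-- `e(φ)` is quasi-totally ordered iff `φ` is. [cite: MochizukiFrdII2008, §0 p.6] -/
theorem isQuasiTotallyOrderedHom_map_equivalence_iff {A B : C} (φ : A ⟶ B) :
    IsQuasiTotallyOrderedHom (e.functor.map φ) ↔ IsQuasiTotallyOrderedHom φ :=
  ⟨fun h => h.of_map_equivalence e, fun h => h.map_equivalence e⟩

/-- An equivalence carries quasi-continuously ordered monomorphisms to quasi-continuously ordered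
monomorphisms. [cite: MochizukiFrdII2008, §0 p.6] -/
theorem IsQuasiContinuouslyOrderedHom.map_equivalence {A B : C} {φ : A ⟶ B}
    (h : IsQuasiContinuouslyOrderedHom φ) : IsQuasiContinuouslyOrderedHom (e.functor.map φ) := by
  haveI := h.1
  refine ⟨inferInstance, h.2.imp (fun hiso => ?_) fun hc => ?_⟩
  · haveI := hiso
    infer_instance
  · exact hc.map_functor e.functor (Q := fun _ _ f => IsContinuouslyOrderedHom f)
      fun f hf => (isContinuouslyOrderedHom_map_equivalence_iff e f).mpr hf

/-- Conversely. [cite: MochizukiFrdII2008, §0 p.6] -/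
theorem IsQuasiContinuouslyOrderedHom.of_map_equivalence {A B : C} {φ : A ⟶ B}
    (h : IsQuasiContinuouslyOrderedHom (e.functor.map φ)) : IsQuasiContinuouslyOrderedHom φ :=
  (h.map_equivalence e.symm).conj (e.unitIso.app A) (e.unitIso.app B).symm
    (by
      show φ = e.unitIso.hom.app A ≫ (e.functor ⋙ e.inverse).map φ ≫ e.unitIso.inv.app B
      rw [← Category.assoc, ← e.unitIso.hom.naturality φ, Category.assoc, Iso.hom_inv_id_app]
      exact (Category.comp_id φ).symm)

/-- `e(φ)` is quasi-continuously ordered iff `φ` is. [cite: MochizukiFrdII2008, §0 p.6] -/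
theorem isQuasiContinuouslyOrderedHom_map_equivalence_iff {A B : C} (φ : A ⟶ B) :
    IsQuasiContinuouslyOrderedHom (e.functor.map φ) ↔ IsQuasiContinuouslyOrderedHom φ :=
  ⟨fun h => h.of_map_equivalence e, fun h => h.map_equivalence e⟩

/-- A category equivalent to one of quasi-totally ordered type is of quasi-totally ordered type.
[cite: MochizukiFrdII2008, §0 p.6] -/
theorem IsOfQuasiTotallyOrderedType.of_equivalence (e : C ≌ D) (h : IsOfQuasiTotallyOrderedType C) :
    IsOfQuasiTotallyOrderedType D :=
  ⟨fun φ' => (isQuasiTotallyOrderedHom_map_equivalence_iff e.symm φ').mp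
    (h.isQuasiTotallyOrderedHom _)⟩

/-- Being of quasi-totally ordered type is invariant under equivalence of categories.
[cite: MochizukiFrdII2008, §0 p.6] -/
theorem isOfQuasiTotallyOrderedType_iff_of_equivalence (e : C ≌ D) :
    IsOfQuasiTotallyOrderedType C ↔ IsOfQuasiTotallyOrderedType D :=
  ⟨fun h => h.of_equivalence e, fun h => h.of_equivalence e.symm⟩

/-- A category equivalent to one of quasi-continuously ordered type is of quasi-continuously ordered
type. [cite: MochizukiFrdII2008, §0 p.6] -/
theorem IsOfQuasiContinuouslyOrderedType.of_equivalence (e : C ≌ D)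
    (h : IsOfQuasiContinuouslyOrderedType C) : IsOfQuasiContinuouslyOrderedType D :=
  ⟨fun φ' => (isQuasiContinuouslyOrderedHom_map_equivalence_iff e.symm φ').mp
    (h.isQuasiContinuouslyOrderedHom _)⟩

/-- Being of quasi-continuously ordered type is invariant under equivalence of categories.
[cite: MochizukiFrdII2008, §0 p.6] -/
theorem isOfQuasiContinuouslyOrderedType_iff_of_equivalence (e : C ≌ D) :
    IsOfQuasiContinuouslyOrderedType C ↔ IsOfQuasiContinuouslyOrderedType D :=
  ⟨fun h => h.of_equivalence e, fun h => h.of_equivalence e.symm⟩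

end Equivalence

end Literature.AlgebraicGeometry.Frobenioids
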